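import Literature.Topology.FourManifolds.LadderSlabGeometry
import Literature.Topology.FourManifolds.LadderCoreBall
import Literature.Topology.FourManifolds.MonotoneReparametrisation
import HarnessLib

/-!
# Relocating the plugs of the core ball of the ladder body along a pair of bridges

Topic `Literature/Topology/FourManifolds`; brick E5a of the constructive road (P1′) to
`Literature.Topology.FourManifolds.Trisection.isConnectedSum_of_reducing_separating`
(`ReducibleTrisectionSplitting.lean`, § Status), on top of `LadderSlabGeometry.lean` (the
round tubes of the ladder body `Z` across slab `i`, the slide `slideU`), `LadderCore.lean` /
`LadderCoreBall.lean` (the core function `coreG`, the core ball `Z₀ = {coreG ≤ 0}`) and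
`MonotoneReparametrisation.lean` (smooth increasing reparametrisations of the line).

In the upper tube of slab `i` the core ball is absent exactly over the **plug**
`{ρ₀ < 0}`, `ρ₀(x) = c' - τx - 4 b(2(x - sc))` (`rho0`; `coreG = |v|² - ρ₀(x)` there,
`coreG_eq_upper`), which contains `|x - sc| ≤ 1/8` (`rho0_neg`, as `4 b(1/4) > 1`) while at
`|x - sc| = 7/16` the inner radius is large (`rho0_ge`, as `b(7/8) < 1/50`).  After the
straightening of `LadderSurfaceStraightening.lean` the window of slab `i` is
`|x - a| ≤ 2η` with `|a - sc| < 1/8` and an uncontrollably small `η`; the plug is moved into it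
by the **relocation** `reloc`: on the slab the slide by `χ₊(y) (ψ(x) - x)` where `ψ` is a
smooth increasing bijection of the line through the knots
`(sc ∓ 15/32, sc ∓ 7/16, sc ∓ 55/128, sc ∓ 1/8) ↦ (sc ∓ 15/32, a ∓ 2η, a ∓ 3η/2, a ∓ 5η/4)` (`RelocData`,
`nonempty_relocData`), the identity elsewhere.  Results: `reloc` is smooth
(`contDiff_reloc`), undone by `relocInv` on the open **good region** `goodSet ⊇ Z`
(`relocInv_reloc`, `reloc_relocInv`, `injOn_reloc`, `injective_fderiv_reloc`), maps `Z` onto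
`Z` and `∂Z` onto `∂Z` (`image_reloc_body`, `image_reloc_bdry`), and for the relocated core
`coreG ∘ relocInv` (`coreG_relocInv`): **the points of `Z` with `|x - a| ≤ 5η/4`, `y ≥ 0` lie
in the relocated plug** (`coreG_relocInv_pos`).  §8 records the quantitative facts used by
the window pieces (`LadderWindowPiece`, brick E5b): the plug contains `|x - sc| ≤ 1/4`
(`rho0_neg'`), `ρ₀ > 1/8` at `|x - sc| = 55/128` (`rho0_overlap_gt`), and on the zones
`1/4 ≤ |x - sc| ≤ 7/16` the squared radius ratio `gSq = ρ₀/R²` of the inner sphere is strictly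
monotone past the tip (`deriv_gSq_pos`, `deriv_gSq_neg`, from `|b'| ≥ 1/45` on `[1/2, 7/8]`,
`dbump_le_of_mem`).

Everything is **proved** (explicit maps); no named fact is introduced.

## References
* J. Milnor, *Lectures on the h-cobordism theorem* (1965), §3. [MilnorHCobordism1965]
-/

noncomputable section

open scoped Topology ContDiff Manifold
open Filter Real

namespace Literature.Topology.FourManifolds

/-- Local notation: `𝔼 n` is the model Euclidean space `EuclideanSpace ℝ (Fin n)`. -/
local notation "𝔼 " n:arg => EuclideanSpace ℝ (Fin n)

open Set Metric
open Literature.Geometry.Symplectic.LegendrianModel (bump bump_nonneg bump_le_bump bump_lt_bump bump_neg dbump dbump_neg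
  hasDerivAt_bump dglue)

namespace Ladder

/-! ### §1 Two values of the bump -/

/-- `4 b(1/4) = 4 e^{-16/15} > 1`. [folklore] -/
theorem one_lt_four_bump_quarter : 1 < 4 * bump (1 / 4) := by
  have hb : bump (1 / 4) = Real.exp (-(16 / 15)) := by
    unfold bump
    rw [expNegInvGlue, if_neg (by norm_num)]
    norm_num
  rw [hb, Real.exp_neg]
  -- `exp (16/15) = e · exp (1/15) ≤ e · 15/14 < 4`
  have h1 : Real.exp (16 / 15) = Real.exp 1 * Real.exp (1 / 15) := by rw [← Real.exp_add]; norm_num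
  have h2 : Real.exp (1 / 15) ≤ 15 / 14 := by
    have h := Real.add_one_le_exp (-(1 / 15 : ℝ))
    rw [Real.exp_neg] at h
    rw [show (15 / 14 : ℝ) = ((-(1/15 : ℝ)) + 1)⁻¹ by norm_num]
    rw [le_inv_comm₀ (by positivity) (by norm_num)]
    exact h
  have h3 := Real.exp_one_lt_d9
  have hpos : 0 < Real.exp (16 / 15) := Real.exp_pos _
  rw [lt_mul_inv_iff₀ hpos]
  nlinarith [Real.exp_pos (1 / 15 : ℝ), Real.exp_pos (1 : ℝ)]

/-- `b(7/8) = e^{-64/15} < 1/50`. [folklore] -/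
theorem bump_seven_eighths_lt : bump (7 / 8) < 1 / 50 := by
  have hb : bump (7 / 8) = Real.exp (-(64 / 15)) := by
    unfold bump
    rw [expNegInvGlue, if_neg (by norm_num)]
    norm_num
  rw [hb, Real.exp_neg, inv_lt_comm₀ (Real.exp_pos _) (by norm_num)]
  have h4 : Real.exp 4 ≤ Real.exp (64 / 15) := Real.exp_le_exp.2 (by norm_num)
  have he : Real.exp 1 ^ 4 = Real.exp 4 := by rw [Real.exp_one_pow]; norm_num
  have h3 := Real.exp_one_gt_d9
  have h2 : (7.38 : ℝ) < Real.exp 1 ^ 2 := by nlinarith [Real.exp_pos (1 : ℝ)]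
  have h5 : (54 : ℝ) < (Real.exp 1 ^ 2) ^ 2 := by nlinarith
  have : (Real.exp 1 ^ 2) ^ 2 = Real.exp 1 ^ 4 := by ring
  show (1 / 50 : ℝ)⁻¹ < Real.exp (64 / 15)
  norm_num
  linarith

namespace Params

variable {k : ℕ} (P : Params k)

/-! ### §2 The inner radius of the core ball over a pair of bridges -/

/-- **`ρ₀(x) = c' - τx - 4 b(2(x - slabCtr i))`**, the squared inner radius of the core ball in
the upper tube of slab `i` (negative across the plug). [folklore] -/
def rho0 (i : ℕ) (x : ℝ) : ℝ := P.coreLevel - P.τ * x - 4 * bump (2 * (x - slabCtr i))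

/-- **On the upper tube the core function is `τx + |v|² - c' + 4 b(2(x - slabCtr i))`**, i.e.
`coreG p = |v|² - ρ₀(x)` (`|x - slabCtr i| ≤ 1/2`, `|y - 1| ≤ 7/8`). [folklore] -/
theorem coreG_eq_upper {i : ℕ} (hi : i < k) {p : 𝔼 4} (hx : |p 0 - slabCtr i| < 1 / 2) (hy : |p 1 - 1| ≤ 7 / 8) :
    P.coreG p = ((p 1 - 1) ^ 2 + p 2 ^ 2 + p 3 ^ 2) - P.rho0 i (p 0) := by
  have hyy := abs_le.1 hy
  rw [show P.coreG p = SolidThickening.thicken₄ (PlanarThickening.thicken P.core) p from rfl,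
    SolidThickening.thicken₄_apply, PlanarThickening.thicken_apply]
  have hcore : P.core (PlanarThickening.proj (SolidThickening.proj₃ p)) = P.coreFun (p 0) (p 1) := rfl
  rw [hcore]
  unfold coreFun
  rw [cutoffY_of_ge (by linarith), slabBump_eq_of_abs_lt hi hx]
  have hG := P.bodyG_eq_upper hi hx.le hy
  rw [bodyG_apply] at hG
  simp only [SolidThickening.proj₃_apply_two]
  unfold rho0
  linarith

/-- **The plug**: `ρ₀ < 0` on `|x - slabCtr i| ≤ 1/8` (there `4b ≥ 4b(1/4) > 1 > c'`). [folklore] -/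
theorem rho0_neg {i : ℕ} (hi : i < k) {x : ℝ} (hx : |x - slabCtr i| ≤ 1 / 8) : P.rho0 i x < 0 := by
  have hc := P.coreLevel_lt_one
  have hx' : |x - slabCtr i| ≤ 1 / 2 := hx.trans (by norm_num)
  obtain ⟨h1, -, -⟩ := slab_hyps hi (x := x) (by unfold slabCtr at hx'; exact hx')
  have hτ := P.τ_pos
  have hb : bump (1 / 4) ≤ bump (2 * (x - slabCtr i)) := by
    refine bump_le_bump ?_
    rw [abs_of_pos (by norm_num : (0:ℝ) < 1/4), abs_le]
    constructor <;> linarith [(abs_le.1 hx).1, (abs_le.1 hx).2]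
  have h4 := one_lt_four_bump_quarter
  unfold rho0
  nlinarith

/-- **At the dip ends `|x - slabCtr i| = 7/16` the inner radius is large**: `ρ₀ ≥ (c - τx)/5`,
i.e. the radius ratio `g = √(ρ₀)/R` is at least `1/√5`. [folklore] -/
theorem rho0_ge {i : ℕ} (hi : i < k) {x : ℝ} (hx : |x - slabCtr i| = 7 / 16) : P.radSq x / 5 ≤ P.rho0 i x := by
  have hb : bump (2 * (x - slabCtr i)) < 1 / 50 := by
    have : bump (2 * (x - slabCtr i)) = bump (7 / 8) := by
      rcases (abs_eq (by norm_num : (0:ℝ) ≤ 7/16)).1 hx with h | h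
      · rw [h]; norm_num
      · rw [h, show (2 : ℝ) * -(7 / 16) = -(7 / 8) by norm_num, bump_neg]
    rw [this]; exact bump_seven_eighths_lt
  have hc := P.coreLevel_gt
  have hcl := P.level_lt_three_quarters
  have hgap : P.level - P.coreLevel < 3 / 32 := by
    have := gapStar_lt_three_eighths; unfold coreLevel; linarith
  have hx' : |x - slabCtr i| ≤ 1 / 2 := by rw [hx]; norm_num
  obtain ⟨h1, h2, -⟩ := slab_hyps hi (x := x) (by unfold slabCtr at hx'; exact hx')
  have hτx : P.τ * x ≤ 1 / 16 := by have := P.τ_mul_xR_le; have hτ := P.τ_pos; nlinarith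
  unfold rho0 radSq
  nlinarith [P.τ_pos]


/-! ### §3 The knots of the relocation and the reparametrisation `ψ` -/

/-- The knots `t = (sc - 15/32, sc - 7/16, sc - 55/128, sc - 1/8, sc + 1/8, sc + 55/128, sc + 7/16, sc + 15/32, …)`
(`sc = slabCtr i`; constant from index `7` on). [folklore] -/
def knotT (i j : ℕ) : ℝ :=
  slabCtr i + if j = 0 then -(15 / 32) else if j = 1 then -(7 / 16) else if j = 2 then -(55 / 128)
    else if j = 3 then -(1 / 8) else if j = 4 then 1 / 8 else if j = 5 then 55 / 128
    else if j = 6 then 7 / 16 else 15 / 32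

/-- The targets `s = (sc - 15/32, a - 2η, a - 3η/2, a - 5η/4, a + 5η/4, a + 3η/2, a + 2η, sc + 15/32, …)`.
[folklore] -/
def knotS (i : ℕ) (a η : ℝ) (j : ℕ) : ℝ :=
  if j = 0 then slabCtr i - 15 / 32 else if j = 1 then a - 2 * η else if j = 2 then a - 3 / 2 * η
    else if j = 3 then a - 5 / 4 * η else if j = 4 then a + 5 / 4 * η else if j = 5 then a + 3 / 2 * η
    else if j = 6 then a + 2 * η else slabCtr i + 15 / 32

omit P in
/-- The knots increase. [folklore] -/
theorem knotT_lt {i j : ℕ} (hj : j < 7) : knotT i j < knotT i (j + 1) := by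
  interval_cases j <;> simp [knotT] <;> linarith

omit P in
/-- The targets increase. [folklore] -/
theorem knotS_lt {i : ℕ} {a η : ℝ} (ha : |a - slabCtr i| < 1 / 8) (hη : 0 < η) (hη' : η ≤ 1 / 16) {j : ℕ} (hj : j < 7) :
    knotS i a η j < knotS i a η (j + 1) := by
  have h := abs_lt.1 ha
  interval_cases j <;> simp [knotS] <;> linarith

/-- **The relocation data**: a smooth increasing bijection `ψ` of `ℝ` with smooth inverse `φ`,
through the knots, equal to the identity off `(sc - 15/32, sc + 15/32)`. [folklore] -/
structure RelocData (i : ℕ) (a η : ℝ) where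
  /-- The reparametrisation. -/
  ψ : ℝ → ℝ
  /-- Its inverse. -/
  φ : ℝ → ℝ
  contDiff_ψ : ContDiff ℝ ∞ ψ
  contDiff_φ : ContDiff ℝ ∞ φ
  deriv_ψ_pos : ∀ x, 0 < deriv ψ x
  strictMono_ψ : StrictMono ψ
  strictMono_φ : StrictMono φ
  φ_ψ : ∀ x, φ (ψ x) = x
  ψ_φ : ∀ y, ψ (φ y) = y
  ψ_knot : ∀ j ≤ 7, ψ (knotT i j) = knotS i a η j
  ψ_of_le : ∀ x ≤ slabCtr i - 15 / 32, ψ x = x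
  ψ_of_ge : ∀ x, slabCtr i + 15 / 32 ≤ x → ψ x = x

omit P in
/-- **Relocation data exist** (`Reparam.exists_reparam`, `Reparam.exists_smooth_inverse`). [folklore] -/
theorem nonempty_relocData {i : ℕ} {a η : ℝ} (ha : |a - slabCtr i| < 1 / 8) (hη : 0 < η) (hη' : η ≤ 1 / 16) :
    Nonempty (RelocData i a η) := by
  obtain ⟨ψ, hψ, hder, hmono, hsurj, hknot, hle, hge⟩ := Reparam.exists_reparam (N := 7) (t := knotT i) (s := knotS i a η)
    (fun j hj => knotT_lt hj) (fun j hj => knotS_lt ha hη hη' hj) (by simp [knotT, knotS]; ring) (by simp [knotT, knotS])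
  obtain ⟨φ, hφ, hφψ, hψφ, hφmono⟩ := Reparam.exists_smooth_inverse hψ hder hmono hsurj
  refine ⟨⟨ψ, φ, hψ, hφ, hder, hmono, hφmono, hφψ, hψφ, hknot, fun x hx => hle x ?_, fun x hx => hge x ?_⟩⟩
  · simp only [knotT]; norm_num; linarith
  · simp only [knotT]; norm_num; linarith

namespace RelocData

variable {P} {i : ℕ} {a η : ℝ} (D : RelocData i a η)

/-- `ψ` is the identity off `|x - sc| < 15/32`. [folklore] -/
theorem ψ_eq_self {x : ℝ} (hx : 15 / 32 ≤ |x - slabCtr i|) : D.ψ x = x := by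
  rcases le_abs'.1 hx with h | h
  · exact D.ψ_of_le x (by linarith)
  · exact D.ψ_of_ge x (by linarith)

/-- `φ` is the identity off `|x - sc| < 15/32`. [folklore] -/
theorem φ_eq_self {x : ℝ} (hx : 15 / 32 ≤ |x - slabCtr i|) : D.φ x = x := by
  conv_lhs => rw [← D.ψ_eq_self hx]
  exact D.φ_ψ x

/-- `ψ` maps the slab `|x - sc| < 1/2` into itself (indeed it fixes the two ends). [folklore] -/
theorem abs_ψ_sub_lt {x : ℝ} (hx : |x - slabCtr i| < 1 / 2) : |D.ψ x - slabCtr i| < 1 / 2 := by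
  have h1 : D.ψ (slabCtr i - 1 / 2) = slabCtr i - 1 / 2 := D.ψ_of_le _ (by linarith)
  have h2 : D.ψ (slabCtr i + 1 / 2) = slabCtr i + 1 / 2 := D.ψ_of_ge _ (by linarith)
  have hlt := abs_lt.1 hx
  rw [abs_lt]; constructor
  · have := D.strictMono_ψ (show slabCtr i - 1 / 2 < x by linarith); linarith
  · have := D.strictMono_ψ (show x < slabCtr i + 1 / 2 by linarith); linarith

/-- The same for `φ`. [folklore] -/
theorem abs_φ_sub_lt {x : ℝ} (hx : |x - slabCtr i| < 1 / 2) : |D.φ x - slabCtr i| < 1 / 2 := by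
  have h1 : D.φ (slabCtr i - 1 / 2) = slabCtr i - 1 / 2 := D.φ_eq_self (by rw [show slabCtr i - 1/2 - slabCtr i = -(1/2:ℝ) by ring, abs_neg]; norm_num)
  have h2 : D.φ (slabCtr i + 1 / 2) = slabCtr i + 1 / 2 := D.φ_eq_self (by rw [show slabCtr i + 1/2 - slabCtr i = (1/2:ℝ) by ring]; norm_num)
  have hlt := abs_lt.1 hx
  rw [abs_lt]; constructor
  · have := D.strictMono_φ (show slabCtr i - 1 / 2 < x by linarith); linarith
  · have := D.strictMono_φ (show x < slabCtr i + 1 / 2 by linarith); linarith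

/-- **`ψ` maps `[sc - 1/8, sc + 1/8]` onto `[a - 5η/4, a + 5η/4]`** (knots `3`, `4`). [folklore] -/
theorem ψ_mem_Icc_iff {x : ℝ} : D.ψ x ∈ Icc (a - 5 / 4 * η) (a + 5 / 4 * η) ↔ x ∈ Icc (slabCtr i - 1 / 8) (slabCtr i + 1 / 8) := by
  have h2 : D.ψ (slabCtr i - 1 / 8) = a - 5 / 4 * η := by
    have := D.ψ_knot 3 (by norm_num); simp only [knotT, knotS] at this; norm_num at this
    rw [show slabCtr i - 1 / 8 = slabCtr i + -(1 / 8) by ring]; exact this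
  have h3 : D.ψ (slabCtr i + 1 / 8) = a + 5 / 4 * η := by
    have := D.ψ_knot 4 (by norm_num); simp only [knotT, knotS] at this; norm_num at this
    exact this
  rw [← h2, ← h3, mem_Icc, mem_Icc, D.strictMono_ψ.le_iff_le, D.strictMono_ψ.le_iff_le]

/-- **`ψ` maps `sc ± 7/16` to `a ± 2η`** (knots `1`, `6`: the ends of the window). [folklore] -/
theorem ψ_dipEnd : D.ψ (slabCtr i - 7 / 16) = a - 2 * η ∧ D.ψ (slabCtr i + 7 / 16) = a + 2 * η := by
  constructor
  · have := D.ψ_knot 1 (by norm_num); simp only [knotT, knotS] at this; norm_num at this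
    rw [show slabCtr i - 7 / 16 = slabCtr i + -(7 / 16) by ring]; exact this
  · have := D.ψ_knot 6 (by norm_num); simp only [knotT, knotS] at this; norm_num at this
    exact this

/-- **`ψ` maps `sc ± 55/128` to `a ± 3η/2`** (knots `2`, `5`: the start of the overlap zone).
[folklore] -/
theorem ψ_overlap : D.ψ (slabCtr i - 55 / 128) = a - 3 / 2 * η ∧ D.ψ (slabCtr i + 55 / 128) = a + 3 / 2 * η := by
  constructor
  · have := D.ψ_knot 2 (by norm_num); simp only [knotT, knotS] at this; norm_num at this
    rw [show slabCtr i - 55 / 128 = slabCtr i + -(55 / 128) by ring]; exact this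
  · have := D.ψ_knot 5 (by norm_num); simp only [knotT, knotS] at this; norm_num at this
    exact this

end RelocData

/-! ### §4 The relocation map `Ξ` -/

omit P in
/-- The selector of the upper half: `0` for `y ≤ 1/20`, `1` for `y ≥ 1/10`. [folklore] -/
def chiUp (y : ℝ) : ℝ := smoothStep (1 / 20) (1 / 10) y

omit P in
/-- Values of the selector. [folklore] -/
theorem chiUp_of_le {y : ℝ} (hy : y ≤ 1 / 20) : chiUp y = 0 := smoothStep_of_le (by norm_num) hy

omit P in
/-- Values of the selector. [folklore] -/
theorem chiUp_of_ge {y : ℝ} (hy : 1 / 10 ≤ y) : chiUp y = 1 := smoothStep_of_ge (by norm_num) hy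

omit P in
/-- The selector is smooth. [folklore] -/
theorem contDiff_chiUp : ContDiff ℝ ∞ chiUp := contDiff_smoothStep _ _

variable {i : ℕ} {a η : ℝ}

/-- The relocation map built from a reparametrisation `f` of the `x`-line: on the slab the slide
by `χ₊(y) (f(x) - x)`, the identity off the slab. [folklore] -/
def relocWith (i : ℕ) (f : ℝ → ℝ) (p : 𝔼 4) : 𝔼 4 :=
  if |p 0 - slabCtr i| < 1 / 2 then P.slideU (chiUp (p 1) * (f (p 0) - p 0)) p else p

/-- **The relocation map** of slab `i` (with `ψ`) and its inverse (with `φ = ψ⁻¹`). [folklore] -/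
def reloc (D : RelocData i a η) : 𝔼 4 → 𝔼 4 := P.relocWith i D.ψ

/-- The inverse relocation. [folklore] -/
def relocInv (D : RelocData i a η) : 𝔼 4 → 𝔼 4 := P.relocWith i D.φ

section With

variable (f : ℝ → ℝ)

/-- Off the slab the relocation is the identity. [folklore] -/
theorem relocWith_of_not_lt {p : 𝔼 4} (hp : ¬ |p 0 - slabCtr i| < 1 / 2) : P.relocWith i f p = p := by
  unfold relocWith; rw [if_neg hp]

/-- On the slab the relocation is the slide. [folklore] -/
theorem relocWith_of_lt {p : 𝔼 4} (hp : |p 0 - slabCtr i| < 1 / 2) :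
    P.relocWith i f p = P.slideU (chiUp (p 1) * (f (p 0) - p 0)) p := by
  unfold relocWith; rw [if_pos hp]

/-- **On the upper part of the slab (`y ≥ 1/10`) the relocation is the clean slide by
`f(x) - x`.** [folklore] -/
theorem relocWith_eq_slideU {p : 𝔼 4} (hp : |p 0 - slabCtr i| < 1 / 2) (hy : 1 / 10 ≤ p 1) :
    P.relocWith i f p = P.slideU (f (p 0) - p 0) p := by
  rw [P.relocWith_of_lt f hp, chiUp_of_ge hy, one_mul]

/-- Where the slide time vanishes the relocation is the identity: `y ≤ 1/20`, or `f x = x`.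
[folklore] -/
theorem relocWith_eq_self (hi : i < k) {p : 𝔼 4} (h : p 1 ≤ 1 / 20 ∨ f (p 0) = p 0) : P.relocWith i f p = p := by
  by_cases hp : |p 0 - slabCtr i| < 1 / 2
  · rw [P.relocWith_of_lt f hp]
    have h0 : chiUp (p 1) * (f (p 0) - p 0) = 0 := by
      rcases h with h | h
      · rw [chiUp_of_le h, zero_mul]
      · rw [h, sub_self, mul_zero]
    rw [h0]
    obtain ⟨-, h2, -⟩ := slab_hyps hi (x := p 0) (by unfold slabCtr at hp; exact hp.le)
    exact P.slideU_zero (by linarith)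
  · exact P.relocWith_of_not_lt f hp

/-- The `x`-coordinate of the relocation on the clean region. [folklore] -/
theorem relocWith_apply_zero {p : 𝔼 4} (hp : |p 0 - slabCtr i| < 1 / 2) (hy : 1 / 10 ≤ p 1) :
    P.relocWith i f p 0 = f (p 0) := by
  rw [P.relocWith_eq_slideU f hp hy, slideU_apply_zero]; ring

/-- **The good region** on which the relocation is controlled: off the active zone, below
`y = 1/20`, or in the slightly enlarged upper tube. [folklore] -/
def goodSet (i : ℕ) : Set (𝔼 4) :=
  {p | 15 / 32 < |p 0 - slabCtr i|} ∪ {p | p 1 < 1 / 20} ∪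
    {p | |p 0 - slabCtr i| < 1 / 2 ∧ 1 / 10 < p 1 ∧ (p 1 - 1) ^ 2 + p 2 ^ 2 + p 3 ^ 2 < (P.rad (p 0) + 1 / 64) ^ 2}

/-- **The ladder body lies in the good region.** [folklore] -/
theorem subset_goodSet (hi : i < k) {p : 𝔼 4} (hp : P.bodyG p ≤ P.level) : p ∈ P.goodSet i := by
  unfold goodSet
  by_cases hx : 15 / 32 < |p 0 - slabCtr i|
  · exact Or.inl (Or.inl hx)
  rw [not_lt] at hx
  have hx2 : |p 0 - slabCtr i| ≤ 1 / 2 := hx.trans (by norm_num)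
  have hx2' : |p 0 - slabCtr i| < 1 / 2 := lt_of_le_of_lt hx (by norm_num)
  rcases lt_or_ge (p 1) (1 / 20) with hy | hy
  · exact Or.inl (Or.inr hy)
  · right
    have h := (P.bodyG_le_iff_upper hi hx2 (by linarith)).1 hp
    obtain ⟨h1, h2, -⟩ := slab_hyps hi (x := p 0) (by unfold slabCtr at hx2; exact hx2)
    have hR := P.rad_sq (show p 0 ≤ xR k + 1 by linarith)
    have hR0 := P.rad_pos (show p 0 ≤ xR k + 1 by linarith)
    have hRlt := P.rad_lt (by linarith) (show p 0 ≤ xR k + 1 by linarith)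
    have hc := P.level_lt_three_quarters
    unfold radSq at hR
    refine ⟨hx2', ?_, ?_⟩
    · -- `y ≥ 1 - R > 1/8`
      have : (p 1 - 1) ^ 2 < 3 / 4 := by nlinarith [sq_nonneg (p 2), sq_nonneg (p 3), P.τ_pos]
      nlinarith
    · nlinarith

variable {f} {g : ℝ → ℝ}

/-- **The relocation with `g = f⁻¹` undoes the relocation with `f` on the good region**
(group law of the slide). [folklore] -/
theorem relocWith_relocWith (hi : i < k) (hgf : ∀ x, g (f x) = x)
    (hslab : ∀ x, |x - slabCtr i| < 1 / 2 → |f x - slabCtr i| < 1 / 2)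
    (hfix : ∀ x, 15 / 32 ≤ |x - slabCtr i| → f x = x) {p : 𝔼 4} (hp : p ∈ P.goodSet i) :
    P.relocWith i g (P.relocWith i f p) = p := by
  rcases hp with (hp | hp) | ⟨hx, hy, hv⟩
  · have h1 : P.relocWith i f p = p := P.relocWith_eq_self f hi (Or.inr (hfix _ hp.le))
    rw [h1]
    refine P.relocWith_eq_self g hi (Or.inr ?_)
    conv_lhs => rw [← hfix _ hp.le]
    exact hgf _
  · have h1 : P.relocWith i f p = p := P.relocWith_eq_self f hi (Or.inl hp.le)
    rw [h1]; exact P.relocWith_eq_self g hi (Or.inl hp.le)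
  · -- the clean region: group law
    obtain ⟨h1, h2, -⟩ := slab_hyps hi (x := p 0) (by unfold slabCtr at hx; exact hx.le)
    have hfx := hslab _ hx
    obtain ⟨h1', h2', -⟩ := slab_hyps hi (x := f (p 0)) (by unfold slabCtr at hfx; exact hfx.le)
    have hxR : p 0 ≤ xR k + 1 := by linarith
    have hfR : f (p 0) ≤ xR k + 1 := by linarith
    rw [P.relocWith_eq_slideU f hx hy.le]
    set q := P.slideU (f (p 0) - p 0) p with hq
    have hq0 : q 0 = f (p 0) := by rw [hq, slideU_apply_zero]; ring
    -- the image stays in the clean region: `y' ≥ 1 - R(f x) - (1/64)(7/4) > 1/10`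
    have hR0 := P.rad_pos hxR
    have hR0' := P.rad_pos hfR
    have hRgt := P.rad_gt hxR
    have hRlt' : P.rad (f (p 0)) ^ 2 < 3 / 4 := by
      rw [P.rad_sq hfR]; unfold radSq; nlinarith [P.level_lt_three_quarters, P.τ_pos]
    have hRs : P.rad (f (p 0)) < 0.867 := by nlinarith
    have hq1 : 1 / 10 ≤ q 1 := by
      have hq1e : q 1 = 1 + (p 1 - 1) * (P.rad (f (p 0)) / P.rad (p 0)) := by
        rw [hq]; unfold slideU; simp only [pt4_apply_one]
        rw [show p 0 + (f (p 0) - p 0) = f (p 0) by ring]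
      rw [hq1e]
      have hv1 : |p 1 - 1| < P.rad (p 0) + 1 / 64 := by
        refine abs_lt_of_sq_lt_sq ?_ (by linarith)
        nlinarith [sq_nonneg (p 2), sq_nonneg (p 3)]
      have hratio : P.rad (f (p 0)) / P.rad (p 0) < 7 / 4 := by
        rw [div_lt_iff₀ hR0]; nlinarith [P.rad_lt (by linarith) hfR]
      have hratio0 : 0 < P.rad (f (p 0)) / P.rad (p 0) := div_pos hR0' hR0
      have : |(p 1 - 1) * (P.rad (f (p 0)) / P.rad (p 0))| ≤ (P.rad (p 0) + 1 / 64) * (P.rad (f (p 0)) / P.rad (p 0)) := by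
        rw [abs_mul, abs_of_pos hratio0]; gcongr
      have e : (P.rad (p 0) + 1 / 64) * (P.rad (f (p 0)) / P.rad (p 0)) =
          P.rad (f (p 0)) + 1 / 64 * (P.rad (f (p 0)) / P.rad (p 0)) := by field_simp
      have := neg_abs_le ((p 1 - 1) * (P.rad (f (p 0)) / P.rad (p 0)))
      nlinarith
    rw [P.relocWith_eq_slideU g (by rw [hq0]; exact hfx) hq1, hq0, hgf, hq,
      ← P.slideU_add hxR (by linarith : p 0 + (f (p 0) - p 0) ≤ xR k + 1)]
    rw [show f (p 0) - p 0 + (p 0 - f (p 0)) = 0 by ring]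
    exact P.slideU_zero hxR

end With

variable (D : RelocData i a η)

/-- **`relocInv ∘ reloc = id` on the good region.** [folklore] -/
theorem relocInv_reloc (hi : i < k) {p : 𝔼 4} (hp : p ∈ P.goodSet i) : P.relocInv D (P.reloc D p) = p :=
  P.relocWith_relocWith hi D.φ_ψ (fun _ hx => D.abs_ψ_sub_lt hx) (fun _ hx => D.ψ_eq_self hx) hp

/-- **`reloc ∘ relocInv = id` on the good region.** [folklore] -/
theorem reloc_relocInv (hi : i < k) {p : 𝔼 4} (hp : p ∈ P.goodSet i) : P.reloc D (P.relocInv D p) = p :=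
  P.relocWith_relocWith hi D.ψ_φ (fun _ hx => D.abs_φ_sub_lt hx) (fun _ hx => D.φ_eq_self hx) hp

/-- **The relocation is injective on the good region.** [folklore] -/
theorem injOn_reloc (hi : i < k) : InjOn (P.reloc D) (P.goodSet i) := fun p hp q hq h => by
  rw [← P.relocInv_reloc D hi hp, ← P.relocInv_reloc D hi hq, h]

/-! ### §5 The relocation preserves the ladder body and its boundary -/

section Preserve

variable {f : ℝ → ℝ}

/-- **The body function along the relocation**: for `p` in the body,
`G(reloc p) - c = μ (G(p) - c)` with `μ > 0`. [folklore] -/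
theorem exists_bodyG_relocWith_sub (hi : i < k) (hslab : ∀ x, |x - slabCtr i| < 1 / 2 → |f x - slabCtr i| < 1 / 2)
    {p : 𝔼 4} (hp : P.bodyG p ≤ P.level) :
    ∃ μ : ℝ, 0 < μ ∧ P.bodyG (P.relocWith i f p) - P.level = μ * (P.bodyG p - P.level) := by
  by_cases hx : |p 0 - slabCtr i| < 1 / 2
  · rcases le_or_gt (p 1) (1 / 20) with hy | hy
    · exact ⟨1, one_pos, by rw [P.relocWith_eq_self f hi (Or.inl hy), one_mul]⟩
    · -- upper tube: the slide scales `G - c`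
      have hy' : 0 ≤ p 1 := by linarith
      have hv : (p 1 - 1) ^ 2 + p 2 ^ 2 + p 3 ^ 2 ≤ P.radSq (p 0) := by
        have := (P.bodyG_le_iff_upper hi hx.le hy').1 hp; unfold radSq; linarith
      obtain ⟨h1, h2, -⟩ := slab_hyps hi (x := p 0) (by unfold slabCtr at hx; exact hx.le)
      have hR : 1 / 4 < P.radSq (p 0) := P.radSq_gt (by linarith)
      -- `y ≥ 1 - R > 1/10`, so the clean formula applies
      have hy10 : 1 / 10 ≤ p 1 := by
        have : (p 1 - 1) ^ 2 < 3 / 4 := by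
          unfold radSq at hv; nlinarith [sq_nonneg (p 2), sq_nonneg (p 3), P.τ_pos, P.level_lt_three_quarters]
        nlinarith
      rw [P.relocWith_eq_slideU f hx hy10]
      have hfx := hslab _ hx
      obtain ⟨h1', h2', -⟩ := slab_hyps hi (x := f (p 0)) (by unfold slabCtr at hfx; exact hfx.le)
      have hRf : 1 / 4 < P.radSq (f (p 0)) := P.radSq_gt (by linarith)
      refine ⟨P.radSq (p 0 + (f (p 0) - p 0)) / P.radSq (p 0), div_pos (by rw [show p 0 + (f (p 0) - p 0) = f (p 0) by ring]; linarith) (by linarith), ?_⟩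
      exact P.bodyG_slideU_sub hi hx.le (by rw [show p 0 + (f (p 0) - p 0) = f (p 0) by ring]; exact hfx.le) hv
  · exact ⟨1, one_pos, by rw [P.relocWith_of_not_lt f hx, one_mul]⟩

/-- The relocation maps the body into the body. [folklore] -/
theorem bodyG_relocWith_le (hi : i < k) (hslab : ∀ x, |x - slabCtr i| < 1 / 2 → |f x - slabCtr i| < 1 / 2)
    {p : 𝔼 4} (hp : P.bodyG p ≤ P.level) : P.bodyG (P.relocWith i f p) ≤ P.level := by
  obtain ⟨μ, hμ, h⟩ := P.exists_bodyG_relocWith_sub hi hslab hp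
  nlinarith

/-- The relocation maps the boundary into the boundary, and only the boundary. [folklore] -/
theorem bodyG_relocWith_eq_iff (hi : i < k) (hslab : ∀ x, |x - slabCtr i| < 1 / 2 → |f x - slabCtr i| < 1 / 2)
    {p : 𝔼 4} (hp : P.bodyG p ≤ P.level) : P.bodyG (P.relocWith i f p) = P.level ↔ P.bodyG p = P.level := by
  obtain ⟨μ, hμ, h⟩ := P.exists_bodyG_relocWith_sub hi hslab hp
  constructor
  · intro h1; rw [h1, sub_self] at h
    have := (mul_eq_zero.1 h.symm).resolve_left hμ.ne'
    linarith
  · intro h1; rw [h1, sub_self, mul_zero, sub_eq_zero] at h; exact h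

end Preserve

/-- **`reloc` maps the ladder body onto itself.** [folklore] -/
theorem image_reloc_body (hi : i < k) : P.reloc D '' {p | P.bodyG p ≤ P.level} = {p | P.bodyG p ≤ P.level} := by
  have hs := fun x (hx : |x - slabCtr i| < 1 / 2) => D.abs_ψ_sub_lt hx
  have hs' := fun x (hx : |x - slabCtr i| < 1 / 2) => D.abs_φ_sub_lt hx
  ext q; constructor
  · rintro ⟨p, hp, rfl⟩; exact P.bodyG_relocWith_le hi hs hp
  · intro hq
    exact ⟨P.relocInv D q, P.bodyG_relocWith_le hi hs' hq, P.reloc_relocInv D hi (P.subset_goodSet hi hq)⟩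

/-- **`reloc` maps the boundary of the ladder body onto itself.** [folklore] -/
theorem image_reloc_bdry (hi : i < k) : P.reloc D '' {p | P.bodyG p = P.level} = {p | P.bodyG p = P.level} := by
  have hs := fun x (hx : |x - slabCtr i| < 1 / 2) => D.abs_ψ_sub_lt hx
  have hs' := fun x (hx : |x - slabCtr i| < 1 / 2) => D.abs_φ_sub_lt hx
  ext q; constructor
  · rintro ⟨p, hp, rfl⟩
    exact (P.bodyG_relocWith_eq_iff hi hs (le_of_eq hp)).2 hp
  · intro hq
    refine ⟨P.relocInv D q, (P.bodyG_relocWith_eq_iff hi hs' (le_of_eq hq)).2 hq,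
      P.reloc_relocInv D hi (P.subset_goodSet hi (le_of_eq hq))⟩

/-! ### §6 The relocated core: the plug sits over `|x - a| ≤ 5η/4`, and the inner radius -/

/-- **The core function pulled back by the inverse relocation, on the upper tube**:
for `q` in the body with `|x - sc| < 1/2`, `y ≥ 0`:
`coreG (relocInv q) = (R(φ x)/R(x))² |v|² - ρ₀(φ x)`. [folklore] -/
theorem coreG_relocInv {q : 𝔼 4} (hi : i < k) (hq : P.bodyG q ≤ P.level) (hx : |q 0 - slabCtr i| < 1 / 2)
    (hy : 0 ≤ q 1) :
    P.coreG (P.relocInv D q) =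
      (P.radSq (D.φ (q 0)) / P.radSq (q 0)) * ((q 1 - 1) ^ 2 + q 2 ^ 2 + q 3 ^ 2) - P.rho0 i (D.φ (q 0)) := by
  have hv : (q 1 - 1) ^ 2 + q 2 ^ 2 + q 3 ^ 2 ≤ P.radSq (q 0) := by
    have := (P.bodyG_le_iff_upper hi hx.le hy).1 hq; unfold radSq; linarith
  obtain ⟨h1, h2, -⟩ := slab_hyps hi (x := q 0) (by unfold slabCtr at hx; exact hx.le)
  have hxR : q 0 ≤ xR k + 1 := by linarith
  have hR : 1 / 4 < P.radSq (q 0) := P.radSq_gt hxR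
  have hy10 : 1 / 10 ≤ q 1 := by
    have : (q 1 - 1) ^ 2 < 3 / 4 := by
      unfold radSq at hv; nlinarith [sq_nonneg (q 2), sq_nonneg (q 3), P.τ_pos, P.level_lt_three_quarters]
    nlinarith
  have hφx := D.abs_φ_sub_lt hx
  obtain ⟨h1', h2', -⟩ := slab_hyps hi (x := D.φ (q 0)) (by unfold slabCtr at hφx; exact hφx.le)
  have hφR : D.φ (q 0) ≤ xR k + 1 := by linarith
  have hR0 := P.rad_pos hxR
  have hR0' := P.rad_pos hφR
  rw [show P.relocInv D q = P.relocWith i D.φ q from rfl, P.relocWith_eq_slideU D.φ hx hy10]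
  set p := P.slideU (D.φ (q 0) - q 0) q with hp
  have hp0 : p 0 = D.φ (q 0) := by rw [hp, slideU_apply_zero]; ring
  -- `|y_p - 1| ≤ R(φ x) < 7/8`
  have hratio : (P.rad (D.φ (q 0)) / P.rad (q 0)) ^ 2 = P.radSq (D.φ (q 0)) / P.radSq (q 0) := by
    rw [div_pow, P.rad_sq hxR, P.rad_sq hφR]
  have hvp : (p 1 - 1) ^ 2 + p 2 ^ 2 + p 3 ^ 2 =
      (P.radSq (D.φ (q 0)) / P.radSq (q 0)) * ((q 1 - 1) ^ 2 + q 2 ^ 2 + q 3 ^ 2) := by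
    rw [hp]; unfold slideU
    simp only [pt4_apply_one, pt4_apply_two, pt4_apply_three]
    rw [← hratio]; ring
  have hyp : |p 1 - 1| ≤ 7 / 8 := by
    have h7 := P.rad_lt (by linarith) hφR
    have hsq : (p 1 - 1) ^ 2 ≤ P.radSq (D.φ (q 0)) := by
      have : (p 1 - 1) ^ 2 ≤ (p 1 - 1) ^ 2 + p 2 ^ 2 + p 3 ^ 2 := by nlinarith [sq_nonneg (p 2), sq_nonneg (p 3)]
      rw [hvp] at this
      have hle : (P.radSq (D.φ (q 0)) / P.radSq (q 0)) * ((q 1 - 1) ^ 2 + q 2 ^ 2 + q 3 ^ 2) ≤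
          (P.radSq (D.φ (q 0)) / P.radSq (q 0)) * P.radSq (q 0) :=
        mul_le_mul_of_nonneg_left hv (div_nonneg (by linarith [P.radSq_gt hφR]) (by linarith))
      rw [div_mul_cancel₀ _ (by linarith : P.radSq (q 0) ≠ 0)] at hle
      linarith
    rw [← P.rad_sq hφR] at hsq
    have := abs_le_of_sq_le_sq' hsq hR0'.le
    rw [abs_le]; constructor <;> linarith [this.1, this.2]
  rw [P.coreG_eq_upper hi (by rw [hp0]; exact hφx) hyp, hvp, hp0]

/-- **The plug of the relocated core**: a point of the body with `|x - a| ≤ 5η/4` and `y ≥ 0`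
is NOT in the relocated core ball `reloc (Z₀)` — `coreG (relocInv q) > 0`. [folklore] -/
theorem coreG_relocInv_pos (hi : i < k) (ha : |a - slabCtr i| < 1 / 8) (hη : 0 < η) (hη' : η ≤ 1 / 16)
    {q : 𝔼 4} (hq : P.bodyG q ≤ P.level) (hxa : |q 0 - a| ≤ 5 / 4 * η) (hy : 0 ≤ q 1) :
    0 < P.coreG (P.relocInv D q) := by
  have hx : |q 0 - slabCtr i| < 1 / 2 := by
    have := abs_sub_le (q 0) a (slabCtr i)
    have h5 : 5 / 4 * η ≤ 5 / 64 := by linarith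
    linarith [ha]
  rw [P.coreG_relocInv D hi hq hx hy]
  -- `φ x ∈ [sc - 1/8, sc + 1/8]`: `ρ₀(φ x) < 0`
  have hmem : D.φ (q 0) ∈ Icc (slabCtr i - 1 / 8) (slabCtr i + 1 / 8) := by
    rw [← D.ψ_mem_Icc_iff, D.ψ_φ]
    rw [mem_Icc]; constructor <;> linarith [(abs_le.1 hxa).1, (abs_le.1 hxa).2]
  have hρ := P.rho0_neg hi (x := D.φ (q 0)) (by rw [abs_le]; constructor <;> linarith [hmem.1, hmem.2])
  obtain ⟨h1, h2, -⟩ := slab_hyps hi (x := q 0) (by unfold slabCtr at hx; exact hx.le)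
  have hφx := D.abs_φ_sub_lt hx
  obtain ⟨h1', h2', -⟩ := slab_hyps hi (x := D.φ (q 0)) (by unfold slabCtr at hφx; exact hφx.le)
  have hR : 1 / 4 < P.radSq (q 0) := P.radSq_gt (by linarith)
  have hR' : 1 / 4 < P.radSq (D.φ (q 0)) := P.radSq_gt (by linarith)
  have : 0 ≤ P.radSq (D.φ (q 0)) / P.radSq (q 0) * ((q 1 - 1) ^ 2 + q 2 ^ 2 + q 3 ^ 2) :=
    mul_nonneg (div_nonneg (by linarith) (by linarith)) (by positivity)
  linarith


/-! ### §7 Smoothness of the relocation; it is a local diffeomorphism on the good region -/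

omit P in
/-- A `pt4`-valued map is `C^n` at a point if its components are. [folklore] -/
theorem contDiffAt_pt4 {E : Type*} [NormedAddCommGroup E] [NormedSpace ℝ E] {n : WithTop ℕ∞} {x : E}
    {f0 f1 f2 f3 : E → ℝ} (h0 : ContDiffAt ℝ n f0 x) (h1 : ContDiffAt ℝ n f1 x) (h2 : ContDiffAt ℝ n f2 x)
    (h3 : ContDiffAt ℝ n f3 x) : ContDiffAt ℝ n (fun x => pt4 (f0 x) (f1 x) (f2 x) (f3 x)) x := by
  rw [contDiffAt_euclidean]
  intro j; fin_cases j
  · exact h0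
  · exact h1
  · exact h2
  · exact h3

section Smooth

variable {f : ℝ → ℝ} (hf : ContDiff ℝ ∞ f)
  (hslab : ∀ x, |x - slabCtr i| < 1 / 2 → |f x - slabCtr i| < 1 / 2)
  (hfix : ∀ x, 15 / 32 ≤ |x - slabCtr i| → f x = x)

include hf hslab in
/-- On the open slab the slide formula of the relocation is smooth. [folklore] -/
theorem contDiffAt_relocWith_formula (hi : i < k) {p : 𝔼 4} (hx : |p 0 - slabCtr i| < 1 / 2) :
    ContDiffAt ℝ ∞ (fun q : 𝔼 4 => P.slideU (chiUp (q 1) * (f (q 0) - q 0)) q) p := by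
  have h0 : ContDiff ℝ ∞ (fun q : 𝔼 4 => q 0) := contDiff_euclidean.1 contDiff_id 0
  have h1 : ContDiff ℝ ∞ (fun q : 𝔼 4 => q 1) := contDiff_euclidean.1 contDiff_id 1
  have h2 : ContDiff ℝ ∞ (fun q : 𝔼 4 => q 2) := contDiff_euclidean.1 contDiff_id 2
  have h3 : ContDiff ℝ ∞ (fun q : 𝔼 4 => q 3) := contDiff_euclidean.1 contDiff_id 3
  have hT : ContDiff ℝ ∞ (fun q : 𝔼 4 => chiUp (q 1) * (f (q 0) - q 0)) :=
    (contDiff_chiUp.comp h1).mul ((hf.comp h0).sub h0)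
  obtain ⟨hp1, hp2, -⟩ := slab_hyps hi (x := p 0) (by unfold slabCtr at hx; exact hx.le)
  have hfx := hslab _ hx
  obtain ⟨hf1, hf2, -⟩ := slab_hyps hi (x := f (p 0)) (by unfold slabCtr at hfx; exact hfx.le)
  -- the slid abscissa stays `≤ x_R`
  have hχ0 := (smoothStep_mem_Icc (1 / 20) (1 / 10) (p 1)).1
  have hχ1 := (smoothStep_mem_Icc (1 / 20) (1 / 10) (p 1)).2
  have hsum : p 0 + chiUp (p 1) * (f (p 0) - p 0) ≤ xR k + 1 := by
    unfold chiUp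
    rcases le_or_gt (f (p 0)) (p 0) with h | h
    · nlinarith
    · nlinarith
  have hradA : ContDiffAt ℝ ∞ P.rad (p 0) := P.contDiffAt_rad (by linarith)
  have hradB : ContDiffAt ℝ ∞ P.rad (p 0 + chiUp (p 1) * (f (p 0) - p 0)) := P.contDiffAt_rad hsum
  have hA : ContDiffAt ℝ ∞ (fun q : 𝔼 4 => P.rad (q 0)) p :=
    ContDiffAt.comp (g := P.rad) (f := fun q : 𝔼 4 => q 0) p hradA h0.contDiffAt
  have hB : ContDiffAt ℝ ∞ (fun q : 𝔼 4 => P.rad (q 0 + chiUp (q 1) * (f (q 0) - q 0))) p :=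
    ContDiffAt.comp (g := P.rad) (f := fun q : 𝔼 4 => q 0 + chiUp (q 1) * (f (q 0) - q 0)) p hradB
      (h0.add hT).contDiffAt
  have hR0 : P.rad (p 0) ≠ 0 := (P.rad_pos (by linarith)).ne'
  have hQ : ContDiffAt ℝ ∞ (fun q : 𝔼 4 => P.rad (q 0 + chiUp (q 1) * (f (q 0) - q 0)) / P.rad (q 0)) p :=
    hB.div hA hR0
  unfold slideU
  exact contDiffAt_pt4 (h0.add hT).contDiffAt
    (contDiffAt_const.add ((h1.contDiffAt.sub contDiffAt_const).mul hQ))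
    (h2.contDiffAt.mul hQ) (h3.contDiffAt.mul hQ)

include hf hslab hfix in
/-- **The relocation is smooth.** [folklore] -/
theorem contDiff_relocWith (hi : i < k) : ContDiff ℝ ∞ (P.relocWith i f) := by
  have hc0 : Continuous (fun q : 𝔼 4 => q 0) := (contDiff_euclidean.1 contDiff_id 0 : ContDiff ℝ ∞ _).continuous
  rw [contDiff_iff_contDiffAt]
  intro p
  by_cases hx : |p 0 - slabCtr i| < 1 / 2
  · -- on the open slab: the slide formula
    have hev : P.relocWith i f =ᶠ[nhds p] fun q => P.slideU (chiUp (q 1) * (f (q 0) - q 0)) q := by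
      have hop : IsOpen {q : 𝔼 4 | |q 0 - slabCtr i| < 1 / 2} :=
        isOpen_lt (continuous_abs.comp (hc0.sub continuous_const)) continuous_const
      filter_upwards [hop.mem_nhds hx] with q hq
      exact P.relocWith_of_lt f hq
    exact (P.contDiffAt_relocWith_formula hf hslab hi hx).congr_of_eventuallyEq hev
  · -- off the slab: the identity, on the open set `15/32 < |x - sc|`
    have hev : P.relocWith i f =ᶠ[nhds p] id := by
      have hop : IsOpen {q : 𝔼 4 | 15 / 32 < |q 0 - slabCtr i|} :=
        isOpen_lt continuous_const (continuous_abs.comp (hc0.sub continuous_const))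
      filter_upwards [hop.mem_nhds (show p ∈ {q : 𝔼 4 | 15 / 32 < |q 0 - slabCtr i|} from by
        show 15 / 32 < |p 0 - slabCtr i|; linarith [not_lt.1 hx])] with q hq
      exact P.relocWith_eq_self f hi (Or.inr (hfix _ (le_of_lt hq)))
    exact contDiffAt_id.congr_of_eventuallyEq hev

end Smooth

/-- **`reloc` is smooth.** [folklore] -/
theorem contDiff_reloc (hi : i < k) : ContDiff ℝ ∞ (P.reloc D) :=
  P.contDiff_relocWith D.contDiff_ψ (fun _ hx => D.abs_ψ_sub_lt hx) (fun _ hx => D.ψ_eq_self hx) hi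

/-- **`relocInv` is smooth.** [folklore] -/
theorem contDiff_relocInv (hi : i < k) : ContDiff ℝ ∞ (P.relocInv D) :=
  P.contDiff_relocWith D.contDiff_φ (fun _ hx => D.abs_φ_sub_lt hx) (fun _ hx => D.φ_eq_self hx) hi

/-- **The good region is open.** [folklore] -/
theorem isOpen_goodSet (hi : i < k) : IsOpen (P.goodSet i) := by
  have hc0 : Continuous (fun q : 𝔼 4 => q 0) := (contDiff_euclidean.1 contDiff_id 0 : ContDiff ℝ ∞ _).continuous
  have hc1 : Continuous (fun q : 𝔼 4 => q 1) := (contDiff_euclidean.1 contDiff_id 1 : ContDiff ℝ ∞ _).continuous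
  have hc2 : Continuous (fun q : 𝔼 4 => q 2) := (contDiff_euclidean.1 contDiff_id 2 : ContDiff ℝ ∞ _).continuous
  have hc3 : Continuous (fun q : 𝔼 4 => q 3) := (contDiff_euclidean.1 contDiff_id 3 : ContDiff ℝ ∞ _).continuous
  unfold goodSet
  refine ((isOpen_lt continuous_const (continuous_abs.comp (hc0.sub continuous_const))).union
    (isOpen_lt hc1 continuous_const)).union ?_
  -- the third piece: `rad ∘ x` is continuous on the open slab
  have hslabOpen : IsOpen {q : 𝔼 4 | |q 0 - slabCtr i| < 1 / 2} :=
    isOpen_lt (continuous_abs.comp (hc0.sub continuous_const)) continuous_const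
  have hcont : ContinuousOn (fun q : 𝔼 4 => (P.rad (q 0) + 1 / 64) ^ 2 - ((q 1 - 1) ^ 2 + q 2 ^ 2 + q 3 ^ 2))
      {q : 𝔼 4 | |q 0 - slabCtr i| < 1 / 2} := by
    intro q hq
    have hq' : |q 0 - slabCtr i| < 1 / 2 := hq
    obtain ⟨-, h2, -⟩ := slab_hyps hi (x := q 0) (by have := hq'.le; unfold slabCtr at this; exact this)
    have hrad : ContinuousAt (fun q : 𝔼 4 => P.rad (q 0)) q :=
      ContinuousAt.comp (g := P.rad) (f := fun q : 𝔼 4 => q 0) ((P.contDiffAt_rad (by linarith)).continuousAt)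
        hc0.continuousAt
    exact (((hrad.add continuousAt_const).pow 2).sub
      ((((hc1.continuousAt.sub continuousAt_const).pow 2).add (hc2.continuousAt.pow 2)).add
        (hc3.continuousAt.pow 2))).continuousWithinAt
  have h3 : {p : 𝔼 4 | |p 0 - slabCtr i| < 1 / 2 ∧ 1 / 10 < p 1 ∧
      (p 1 - 1) ^ 2 + p 2 ^ 2 + p 3 ^ 2 < (P.rad (p 0) + 1 / 64) ^ 2} =
      ({q : 𝔼 4 | |q 0 - slabCtr i| < 1 / 2} ∩
        (fun q : 𝔼 4 => (P.rad (q 0) + 1 / 64) ^ 2 - ((q 1 - 1) ^ 2 + q 2 ^ 2 + q 3 ^ 2)) ⁻¹' Ioi 0) ∩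
        {q : 𝔼 4 | 1 / 10 < q 1} := by
    ext q; simp only [mem_setOf_eq, mem_inter_iff, mem_preimage, mem_Ioi, sub_pos]; tauto
  rw [h3]
  exact (hcont.isOpen_inter_preimage hslabOpen isOpen_Ioi).inter (isOpen_lt continuous_const hc1)

/-- **On the good region the relocation has injective differential** (its smooth inverse
`relocInv` undoes it nearby). [folklore] -/
theorem injective_fderiv_reloc (hi : i < k) {p : 𝔼 4} (hp : p ∈ P.goodSet i) :
    Function.Injective (fderiv ℝ (P.reloc D) p) := by
  have hev : (P.relocInv D ∘ P.reloc D) =ᶠ[nhds p] id := by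
    filter_upwards [(P.isOpen_goodSet hi).mem_nhds hp] with q hq
    exact P.relocInv_reloc D hi hq
  have hd1 : DifferentiableAt ℝ (P.reloc D) p := (P.contDiff_reloc D hi).differentiable (by simp) p
  have hd2 : DifferentiableAt ℝ (P.relocInv D) (P.reloc D p) :=
    (P.contDiff_relocInv D hi).differentiable (by simp) _
  have hcomp := fderiv_comp p hd2 hd1
  rw [hev.fderiv_eq, fderiv_id] at hcomp
  intro v w hvw
  have := congrArg (fderiv ℝ (P.relocInv D) (P.reloc D p)) hvw
  rwa [← ContinuousLinearMap.comp_apply, ← ContinuousLinearMap.comp_apply, ← hcomp] at this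


/-! ### §8 Quantitative facts on the inner radius for the window zones -/

omit P in
/-- `b(7/8) = e^{-64/15} > 1/80` (`e^{64/15} = e⁴ e^{4/15} < 54.6 · 15/11 < 80`). [folklore] -/
theorem bump_seven_eighths_gt : 1 / 80 < bump (7 / 8) := by
  have hb : bump (7 / 8) = Real.exp (-(64 / 15)) := by
    unfold bump
    rw [expNegInvGlue, if_neg (by norm_num)]
    norm_num
  rw [hb, Real.exp_neg, lt_inv_comm₀ (by norm_num) (Real.exp_pos _)]
  have h1 : Real.exp (64 / 15) = Real.exp 1 ^ 4 * Real.exp (4 / 15) := by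
    rw [Real.exp_one_pow, ← Real.exp_add]; norm_num
  have h2 : Real.exp (4 / 15) ≤ 15 / 11 := by
    have h := Real.add_one_le_exp (-(4 / 15 : ℝ))
    rw [Real.exp_neg] at h
    rw [show (15 / 11 : ℝ) = ((-(4 / 15 : ℝ)) + 1)⁻¹ by norm_num, le_inv_comm₀ (by positivity) (by norm_num)]
    exact h
  have h3 := Real.exp_one_lt_d9
  have h0 := Real.exp_pos (1 : ℝ)
  have h4 : Real.exp 1 ^ 2 < 7.39 := by nlinarith
  have h5 : Real.exp 1 ^ 4 < 54.7 := by nlinarith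
  rw [show (1 / 80 : ℝ)⁻¹ = 80 by norm_num, h1]
  nlinarith [Real.exp_pos (4 / 15 : ℝ), pow_pos h0 4]

omit P in
/-- `b(55/64) = e^{-4096/1071} < 1/36` (`e^{4096/1071} ≥ e³ (1 + 883/1071) > 20 · 1.82 > 36`). [folklore] -/
theorem bump_55_64_lt : bump (55 / 64) < 1 / 36 := by
  have hb : bump (55 / 64) = Real.exp (-(4096 / 1071)) := by
    unfold bump
    rw [expNegInvGlue, if_neg (by norm_num)]
    norm_num
  rw [hb, Real.exp_neg, inv_lt_comm₀ (Real.exp_pos _) (by norm_num)]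
  have h1 : Real.exp (4096 / 1071) = Real.exp 1 ^ 3 * Real.exp (883 / 1071) := by
    rw [Real.exp_one_pow, ← Real.exp_add]; norm_num
  have h2 : (883 / 1071 : ℝ) + 1 ≤ Real.exp (883 / 1071) := Real.add_one_le_exp _
  have h3 := Real.exp_one_gt_d9
  have h0 := Real.exp_pos (1 : ℝ)
  have h4a : (7.389 : ℝ) < Real.exp 1 ^ 2 := by nlinarith
  have h4 : (20.08 : ℝ) < Real.exp 1 ^ 3 := by nlinarith
  rw [show (1 / 36 : ℝ)⁻¹ = 36 by norm_num, h1]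
  nlinarith [Real.exp_pos (883 / 1071 : ℝ)]

omit P in
/-- **The derivative of the bump in closed form**: `b'(t) = -2t b(t)/(1 - t²)²` for `|t| < 1`.
[folklore] -/
theorem dbump_eq {t : ℝ} (ht : |t| < 1) : dbump t = -2 * t * bump t / (1 - t ^ 2) ^ 2 := by
  have h1 : 0 < 1 - t ^ 2 := by have := abs_lt.1 ht; nlinarith [sq_abs t, abs_nonneg t]
  unfold dbump bump
  rw [dglue, if_pos h1, expNegInvGlue, if_neg (not_le.2 h1)]
  field_simp

omit P in
/-- **On `[1/2, 7/8]` the bump decreases at rate at least `1/45`**: `b'(t) ≤ -1/45`. [folklore] -/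
theorem dbump_le_of_mem {t : ℝ} (ht : t ∈ Icc (1 / 2 : ℝ) (7 / 8)) : dbump t ≤ -(1 / 45) := by
  have h78 := bump_seven_eighths_gt
  have hb : bump (7 / 8) ≤ bump t := bump_le_bump (by rw [abs_of_pos (by linarith [ht.1]), abs_of_pos (by norm_num)]; exact ht.2)
  rw [dbump_eq (by rw [abs_of_pos (by linarith [ht.1])]; linarith [ht.2])]
  have h0 : 0 < 1 - t ^ 2 := by nlinarith [ht.1, ht.2]
  have h1 : 0 < (1 - t ^ 2) ^ 2 := by positivity
  rw [div_le_iff₀ h1]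
  have h2 : (1 - t ^ 2) ^ 2 ≤ 9 / 16 := by
    have : 1 - t ^ 2 ≤ 3 / 4 := by nlinarith [ht.1]
    nlinarith
  nlinarith [ht.1, bump_nonneg t]

omit P in
/-- The mirror statement on `[-7/8, -1/2]`: `b'(t) ≥ 1/45`. [folklore] -/
theorem le_dbump_of_mem {t : ℝ} (ht : t ∈ Icc (-(7 / 8) : ℝ) (-(1 / 2))) : 1 / 45 ≤ dbump t := by
  have := dbump_le_of_mem (t := -t) ⟨by linarith [ht.2], by linarith [ht.1]⟩
  rw [dbump_neg] at this
  linarith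

/-- **The derivative of `ρ₀`**: `ρ₀'(x) = -τ - 8 b'(2(x - sc))`. [folklore] -/
theorem hasDerivAt_rho0 (i : ℕ) (x : ℝ) :
    HasDerivAt (P.rho0 i) (-P.τ - 8 * dbump (2 * (x - slabCtr i))) x := by
  unfold rho0
  have h1 : HasDerivAt (fun x => P.coreLevel - P.τ * x) (-P.τ) x := by
    simpa using ((hasDerivAt_id x).const_mul P.τ).const_sub P.coreLevel
  have hg : HasDerivAt (fun x => 2 * (x - slabCtr i)) 2 x := by
    simpa using ((hasDerivAt_id x).sub_const (slabCtr i)).const_mul (2 : ℝ)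
  have h2 : HasDerivAt (fun x => 4 * bump (2 * (x - slabCtr i))) (8 * dbump (2 * (x - slabCtr i))) x := by
    have h4 := ((hasDerivAt_bump (2 * (x - slabCtr i))).comp x hg).const_mul (4 : ℝ)
    simp only [Function.comp_def] at h4
    exact h4.congr_deriv (by ring)
  exact h1.sub h2

/-- **The plug contains `|x - sc| ≤ 1/4`** (there `4b ≥ 4b(1/2) > 1 > c'`). [folklore] -/
theorem rho0_neg' {i : ℕ} (hi : i < k) {x : ℝ} (hx : |x - slabCtr i| ≤ 1 / 4) : P.rho0 i x < 0 := by
  have hc := P.coreLevel_lt_one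
  have hx' : |x - slabCtr i| ≤ 1 / 2 := hx.trans (by norm_num)
  obtain ⟨h1, -, -⟩ := slab_hyps hi (x := x) (by unfold slabCtr at hx'; exact hx')
  have hτ := P.τ_pos
  have hb : bump (1 / 2) ≤ bump (2 * (x - slabCtr i)) := by
    refine bump_le_bump ?_
    rw [abs_of_pos (by norm_num : (0:ℝ) < 1/2), abs_le]
    constructor <;> linarith [(abs_le.1 hx).1, (abs_le.1 hx).2]
  have h4 := quarter_lt_bump_half
  unfold rho0
  nlinarith

/-- **At the start of the overlap zone (`|x - sc| = 55/128`) the inner radius is large**: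
`ρ₀ > 1/8 ≥ radSq/6`. [folklore] -/
theorem rho0_overlap_gt {i : ℕ} (hi : i < k) {x : ℝ} (hx : |x - slabCtr i| = 55 / 128) :
    1 / 8 < P.rho0 i x ∧ P.radSq x / 6 < P.rho0 i x := by
  have hb : bump (2 * (x - slabCtr i)) < 1 / 36 := by
    have : bump (2 * (x - slabCtr i)) = bump (55 / 64) := by
      rcases (abs_eq (by norm_num : (0:ℝ) ≤ 55/128)).1 hx with h | h
      · rw [h]; norm_num
      · rw [h, show (2 : ℝ) * -(55 / 128) = -(55 / 64) by norm_num, bump_neg]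
    rw [this]; exact bump_55_64_lt
  have hc := P.coreLevel_gt
  have hcl := P.level_lt_three_quarters
  have hx' : |x - slabCtr i| ≤ 1 / 2 := by rw [hx]; norm_num
  obtain ⟨h1, h2, -⟩ := slab_hyps hi (x := x) (by unfold slabCtr at hx'; exact hx')
  have hτx : P.τ * x ≤ 1 / 16 := by have := P.τ_mul_xR_le; have hτ := P.τ_pos; nlinarith
  unfold rho0 radSq
  constructor <;> nlinarith [P.τ_pos]

/-- **`ρ₀` increases at rate `> 1/9` on the right zone `[sc + 1/4, sc + 7/16]`.** [folklore] -/
theorem deriv_rho0_gt {i : ℕ} {x : ℝ} (hx : x ∈ Icc (slabCtr i + 1 / 4) (slabCtr i + 7 / 16)) :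
    1 / 9 < deriv (P.rho0 i) x := by
  rw [(P.hasDerivAt_rho0 i x).deriv]
  have h := dbump_le_of_mem (t := 2 * (x - slabCtr i)) ⟨by linarith [hx.1], by linarith [hx.2]⟩
  have hτ := P.τ_le
  linarith

/-- **`ρ₀` decreases at rate `> 1/9` on the left zone `[sc - 7/16, sc - 1/4]`.** [folklore] -/
theorem deriv_rho0_lt {i : ℕ} {x : ℝ} (hx : x ∈ Icc (slabCtr i - 7 / 16) (slabCtr i - 1 / 4)) :
    deriv (P.rho0 i) x < -(8 / 45) := by
  rw [(P.hasDerivAt_rho0 i x).deriv]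
  have h := le_dbump_of_mem (t := 2 * (x - slabCtr i)) ⟨by linarith [hx.1], by linarith [hx.2]⟩
  have hτ := P.τ_pos
  linarith

/-- The squared radius ratio `g² = ρ₀/R²` of the inner sphere of the core ball. [folklore] -/
def gSq (i : ℕ) (x : ℝ) : ℝ := P.rho0 i x / P.radSq x

/-- **The derivative of `g²`**: `(ρ₀' R² + τ ρ₀)/R⁴`. [folklore] -/
theorem hasDerivAt_gSq (i : ℕ) {x : ℝ} (hx : x ≤ xR k + 1) :
    HasDerivAt (P.gSq i) ((deriv (P.rho0 i) x * P.radSq x + P.τ * P.rho0 i x) / P.radSq x ^ 2) x := by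
  have hR := P.radSq_gt hx
  have h1 := P.hasDerivAt_rho0 i x
  have h2 : HasDerivAt P.radSq (-P.τ) x := by
    unfold radSq; simpa using ((hasDerivAt_id x).const_mul P.τ).const_sub P.level
  have h := h1.div h2 (by linarith)
  rw [h1.deriv]
  unfold gSq
  exact h.congr_deriv (by ring)

/-- **On the right zone, past the tip, `g²` is strictly increasing**: `(g²)' > 0` where
`ρ₀ ≥ 0`. [folklore] -/
theorem deriv_gSq_pos {i : ℕ} (hi : i < k) {x : ℝ} (hx : x ∈ Icc (slabCtr i + 1 / 4) (slabCtr i + 7 / 16))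
    (hρ : 0 ≤ P.rho0 i x) : 0 < deriv (P.gSq i) x := by
  have hx' : |x - slabCtr i| ≤ 1 / 2 := by rw [abs_le]; constructor <;> linarith [hx.1, hx.2]
  obtain ⟨h1, h2, -⟩ := slab_hyps hi (x := x) (by unfold slabCtr at hx'; exact hx')
  have hxR : x ≤ xR k + 1 := by linarith
  rw [(P.hasDerivAt_gSq i hxR).deriv]
  have hR := P.radSq_gt hxR
  have hd := P.deriv_rho0_gt hx
  exact div_pos (by nlinarith [P.τ_pos]) (by positivity)

/-- **On the left zone, past the tip, `g²` is strictly decreasing in `x`.** [folklore] -/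
theorem deriv_gSq_neg {i : ℕ} (hi : i < k) {x : ℝ} (hx : x ∈ Icc (slabCtr i - 7 / 16) (slabCtr i - 1 / 4))
    (hρ : 0 ≤ P.rho0 i x) : deriv (P.gSq i) x < 0 := by
  have hx' : |x - slabCtr i| ≤ 1 / 2 := by rw [abs_le]; constructor <;> linarith [hx.1, hx.2]
  obtain ⟨h1, h2, -⟩ := slab_hyps hi (x := x) (by unfold slabCtr at hx'; exact hx')
  have hxR : x ≤ xR k + 1 := by linarith
  rw [(P.hasDerivAt_gSq i hxR).deriv]
  have hR := P.radSq_gt hxR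
  have hd := P.deriv_rho0_lt hx
  -- `R² > 27/80` and `ρ₀ ≤ c' < 3/4`, `τ ≤ 1/16`
  have hR' : 27 / 80 < P.radSq x := by
    unfold radSq; have := P.level_gt'; have := P.τ_mul_xR_le; have hτ := P.τ_pos; nlinarith
  have hρle : P.rho0 i x < 3 / 4 := by
    unfold rho0
    have := P.coreLevel_lt_one; have := P.level_lt_three_quarters
    have hτ := P.τ_pos
    have : P.coreLevel ≤ P.level := by unfold coreLevel; linarith [gapStar_pos]
    nlinarith [bump_nonneg (2 * (x - slabCtr i))]
  have hτ := P.τ_le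
  have hτ0 := P.τ_pos
  refine div_neg_of_neg_of_pos ?_ (by positivity)
  nlinarith

end Params

end Ladder

end Literature.Topology.FourManifolds
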